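import Summits.QuantumFields.YangMills.Theorems.PencilRigidityNPointIsotropySandwichVacuumRowOfKernelHelpers
import Summits.QuantumFields.YangMills.Theorems.NPointIsotropy.Negative.TieLoadBearing
import Literature.MathematicalPhysics.QuantumFieldTheory.OSReconstructionNoE1
import HarnessLib

/-!
# `PencilRigidity.NPointIsotropy`: CALIBRATION — the vacuum row of the sandwich bound Σ is a theorem under the kernel
triple, with exponent `4 - η/2` (generation 12 of line `complex-rotation-bandlimit`, crux stmt-QuantumFields-11686; registered
stub `stub_sandwichVacuumRowOfKernel`)

Generation 12 of the line reduces crux 11686 to two Yang–Mills inputs, one of which is the transversely filtered heat-sandwich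
bound Σ: `‖Ψ_{f₁ ⊗ W_{(2u+v)e₀}}‖ ≤ C · Mg · (Mh + Mh') · (u^{-μ} + v^{-μ}) · ‖Ψ_W‖`, `μ < 4`, for one-point insertions
`f₁(x) = g(x⁰,x¹) hh(x²,x³)` whose times lie in `[u, 2u]`, in front of arbitrary time-ordered `W`.  This file proves its DEGREE-ZERO
ROW (`W` of degree `0`, a constant `c = W()` on the one-point space `(ℝ⁴)⁰`) whenever the two-point function on `⁰𝒮` is a kernel
`K(x₀ − x₁)` with `|K x| ≤ C (1 + ‖x‖^(η−10))`, `0 < η ≤ 2`, with the exponent `μ = 4 − η/2 < 4` — model-blind real analysis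
(the helper file `…SandwichVacuumRowOfKernelHelpers.lean`) plus the Osterwalder–Schrader inner-product formula:

* `SandwichVacuumRow.norm_fieldVec_zero` — `‖Ψ_W‖ = |W()|` in degree `0` (normalisation `𝔖₀ F = F()`);
* `SandwichVacuumRow.norm_fieldVec_one_sq_le` — `‖Ψ_{f₁ ⊗ W_a}‖² = 𝔖₂(Θ(f₁ ⊗ W_a)* ⊗ (f₁ ⊗ W_a)) = ∫ K(x₀ − x₁) · (doubled test
  function)` (the doubled function is off-diagonal: times in `[−2u, −u]` against `[u, 2u]`), bounded through
  `SandwichVacuumRow.double_lintegral_bound` by `|W()|² C⁺ Mg² Mh (Mh + u^{η−8} L_η Mh')`, `L_η = ∫_{ℝ²} (1 + |w|²)^{−(10−η)/2} dw`;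
* `stub_sandwichVacuumRowOfKernel` (registered signature verbatim) — with `C' = √(C⁺ (1 + L_η))`:
  `Mh (Mh + u^{η−8} L Mh') ≤ (1 + L)(Mh + Mh')² u^{η−8}` (`u ≤ 1`) and `u^{η−8} = (u^{−(4−η/2)})² ≤ (u^{−(4−η/2)} + v^{−(4−η/2)})²`.

Meaning: Σ's exponent convention is right — on the vacuum row `μ < 4 ⟺ η > 0`, i.e. two-point UV degree `< 10`; the isotropic
dimension-4 `tr F²`-like kernel `|x|⁻⁸` (`η = 2`) has `μ = 3`.

References: K. Osterwalder, R. Schrader, Comm. Math. Phys. 31 (1973) 83–112, §4.1 (4.3)–(4.4) (the form `𝔖(ΘF* ⊗ G)`);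
J. Glimm, A. Jaffe, Quantum Physics (1987) §6.1, §19.5 (sandwich estimates). [folklore]
-/

noncomputable section

namespace Summit.QuantumFields.YangMills.Theorems.NPointIsotropy.ComplexRotationBandlimit

open scoped ENNReal SchwartzMap InnerProductSpace ComplexConjugate
open MeasureTheory
open Literature.MathematicalPhysics.QuantumLattice Literature.MathematicalPhysics.AQFT
  Literature.MathematicalPhysics.QuantumFieldTheory
open Summit.QuantumFields.YangMills.Theorems.NPointIsotropy.Negative (E4)

namespace SandwichVacuumRow

/-! ### The OS side: norms of degree-0 and degree-1 field vectors -/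

/-- **Degree zero**: `‖Ψ_W‖ = |W()|` under the normalisation `𝔖₀ F = F()` (`⟪Ψ_W, Ψ_W⟫ = 𝔖₀(ΘW* ⊗ W) = conj W() · W()`). [folklore] -/
theorem norm_fieldVec_zero {S₁ : SchwingerFamily E4} (h : OSReconstructionNoE1 S₁.toLabelled)
    (h0 : S₁.toLabelled.IsNormalized) (W : 𝓢((Fin 0 → E4), ℂ)) (hW : IsTimeOrdered W) :
    ‖h.fieldVec 0 (fun _ => ()) W hW‖ = ‖W default‖ := by
  have key : ∀ p q : Fin 0 → E4, conj (W p) * W q = ((‖W default‖ ^ 2 : ℝ) : ℂ) := by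
    intro p q
    rw [Subsingleton.elim p default, Subsingleton.elim q default, Complex.conj_mul']
    push_cast
    rfl
  have h1 : ⟪h.fieldVec 0 (fun _ => ()) W hW, h.fieldVec 0 (fun _ => ()) W hW⟫_ℂ = ((‖W default‖ ^ 2 : ℝ) : ℂ) := by
    rw [h.inner_fieldVec_fieldVec (fun _ => ()) (fun _ => ()) hW hW (isAppendTensorOf_appendTensor _ _)]
    have e := h0 (Fin.append ((fun _ : Fin 0 => ()) ∘ Fin.rev) (fun _ : Fin 0 => ()))
      ((osAdjoint W).appendTensor W)
    rw [SchwartzMap.appendTensor_apply, osAdjoint_apply] at e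
    exact e.trans (key _ _)
  have h2 : ‖h.fieldVec 0 (fun _ => ()) W hW‖ ^ 2 = ‖W default‖ ^ 2 := by
    have := inner_self_eq_norm_sq (𝕜 := ℂ) (h.fieldVec 0 (fun _ => ()) W hW)
    rw [h1] at this
    exact_mod_cast this.symm
  exact (sq_eq_sq₀ (norm_nonneg _) (norm_nonneg _)).1 h2

/-- **Degree one, squared norm under the kernel triple**: for `Φ = f₁ ⊗ W_a` time-ordered, `f₁(x) = g(x⁰,x¹) hh(x²,x³)` with the
times of `g` in `[u, 2u]`, and `𝔖₂ = ∫ K(x₀ − x₁) ·` on `⁰𝒮` with `|K x| ≤ C (1 + |x|^{η−10})`: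
`‖Ψ_Φ‖² = Re 𝔖₂(ΘΦ* ⊗ Φ) ≤ ∫ |K| |ΘΦ* ⊗ Φ| = |W()|² ∫∫ |K(x₀−x₁)| |f₁(θx₀)| |f₁(x₁)| ≤ |W()|² C⁺ Mg² Mh (Mh + u^{η−8} L Mh')`
(`ΘΦ* ⊗ Φ ∈ ⁰𝒮` by `isOffDiagonal_appendTensor_osAdjoint`; the last step is `double_lintegral_bound`). [folklore] -/
theorem norm_fieldVec_one_sq_le {S₁ : SchwingerFamily E4} (h : OSReconstructionNoE1 S₁.toLabelled)
    {K : E4 → ℝ} {C η u Mg Mh Mh' L : ℝ} (hη2 : η ≤ 2) (hu : 0 < u)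
    (hK : ∀ x : E4, x ≠ 0 → |K x| ≤ C * (1 + ‖x‖ ^ (η - 10)))
    (hK2 : ∀ F : 𝓢((Fin 2 → E4), ℂ), IsOffDiagonal F →
      Integrable (fun x : Fin 2 → E4 => (K (x 0 - x 1) : ℂ) * F x) ∧
        S₁ 2 F = ∫ x : Fin 2 → E4, (K (x 0 - x 1) : ℂ) * F x)
    (f₁ : 𝓢((Fin 1 → E4), ℂ)) {g hh : ℝ × ℝ → ℂ}
    (hf₁ : ∀ x : Fin 1 → E4, f₁ x = g (x 0 0, x 0 1) * hh (x 0 2, x 0 3))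
    (hgu : ∀ p : ℝ × ℝ, g p ≠ 0 → u ≤ p.1 ∧ p.1 ≤ 2 * u)
    (hgi : Integrable g) (hgM : (∫ p, ‖g p‖) ≤ Mg)
    (hhi : Integrable hh) (hhM : (∫ p, ‖hh p‖) ≤ Mh) (hhM' : ∀ p, ‖hh p‖ ≤ Mh')
    (hL0 : 0 ≤ L) (hL : ∫⁻ w : ℝ × ℝ, ENNReal.ofReal ((1 + ‖w‖ ^ 2) ^ (-(10 - η) / 2)) ≤ ENNReal.ofReal L)
    (a : E4) (W : 𝓢((Fin 0 → E4), ℂ)) (hFW : IsTimeOrdered (f₁.appendTensor (translateMulti a W))) :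
    ‖h.fieldVec (1 + 0) (fun _ => ()) (f₁.appendTensor (translateMulti a W)) hFW‖ ^ 2 ≤
      ‖W default‖ ^ 2 * (max C 0 * (Mg * Mh) * (Mg * (Mh + u ^ (η - 8) * L * Mh'))) := by
  have hMg : 0 ≤ Mg := (integral_nonneg fun _ => norm_nonneg _).trans hgM
  have hMh : 0 ≤ Mh := (integral_nonneg fun _ => norm_nonneg _).trans hhM
  have hMh' : 0 ≤ Mh' := (norm_nonneg _).trans (hhM' 0)
  have hu8 : 0 ≤ u ^ (η - 8) := Real.rpow_nonneg hu.le _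
  -- the doubled test function `D = ΘΦ* ⊗ Φ` at arity `2`, its pointwise form and off-diagonality
  obtain ⟨D, hD⟩ : ∃ D : 𝓢((Fin 2 → E4), ℂ),
      D = (osAdjoint (f₁.appendTensor (translateMulti a W))).appendTensor (f₁.appendTensor (translateMulti a W)) :=
    ⟨_, rfl⟩
  have hDx : ∀ x : Fin 2 → E4,
      D x = conj (f₁ (fun _ => timeReflection 4 (x 0)) * W default) * (f₁ (fun _ => x 1) * W default) := by
    intro x
    obtain ⟨c, hc⟩ : ∃ c, ∀ p, W p = c := ⟨W default, fun p => congrArg W (Subsingleton.elim _ _)⟩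
    obtain ⟨ψ, hψ⟩ : ∃ ψ : E4 → ℂ, ∀ p, f₁ p = ψ (p 0) :=
      ⟨fun q => f₁ (fun _ => q), fun p => congrArg f₁ (funext fun i => by rw [Subsingleton.elim i 0])⟩
    rw [hD]
    erw [SchwartzMap.appendTensor_apply]
    rw [osAdjoint_apply, SchwartzMap.appendTensor_apply, SchwartzMap.appendTensor_apply, translateMulti_apply,
      translateMulti_apply]
    simp only [hc, hψ, Function.comp_apply]
    rfl
  have hDoff : IsOffDiagonal D := by
    rw [hD]; exact OSReconstructionNoE1.isOffDiagonal_appendTensor_osAdjoint hFW hFW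
  -- `‖Ψ_Φ‖² = Re 𝔖₂(D) = Re ∫ K · D ≤ ∫ |K D|`
  have hsq : ‖h.fieldVec (1 + 0) (fun _ => ()) (f₁.appendTensor (translateMulti a W)) hFW‖ ^ 2 = (S₁ 2 D).re := by
    rw [← inner_self_eq_norm_sq (𝕜 := ℂ), h.inner_fieldVec_fieldVec (fun _ => ()) (fun _ => ()) hFW hFW
      (isAppendTensorOf_appendTensor _ _), hD]
    rfl
  rw [hsq, (hK2 D hDoff).2, ← ENNReal.toReal_ofReal (by positivity : 0 ≤ ‖W default‖ ^ 2 * _)]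
  refine (Complex.re_le_norm _).trans ((norm_integral_le_lintegral_norm _).trans
    (ENNReal.toReal_mono ENNReal.ofReal_ne_top ?_))
  -- pointwise: `|K D| = |W()|² |K(x₀ − x₁)| |f₁(θx₀)| |f₁(x₁)|`
  have hpt : ∀ x : Fin 2 → E4, ENNReal.ofReal ‖(K (x 0 - x 1) : ℂ) * D x‖ =
      ‖W default‖ₑ ^ 2 * (‖K (x 0 - x 1)‖ₑ * ‖f₁ (fun _ => timeReflection 4 (x 0))‖ₑ * ‖f₁ (fun _ => x 1)‖ₑ) := by
    intro x
    have e1 : ‖(K (x 0 - x 1) : ℂ)‖ₑ = ‖K (x 0 - x 1)‖ₑ := by rw [← ofReal_norm, Complex.norm_real, ofReal_norm]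
    have e2 : ∀ z : ℂ, ‖conj z‖ₑ = ‖z‖ₑ := fun z => by rw [← ofReal_norm, Complex.norm_conj, ofReal_norm]
    rw [ofReal_norm, hDx, enorm_mul, enorm_mul, e1, e2, enorm_mul, enorm_mul]
    ring
  -- the analytic core for `ψ(x) = f₁(x)`
  have hψc : Continuous fun q : E4 => f₁ (fun _ => q) := f₁.continuous.comp (continuous_pi fun _ => continuous_id)
  have hcore := double_lintegral_bound (ψ := fun q : E4 => f₁ (fun _ => q)) hη2 hu hK hψc (fun q => hf₁ _)
    hgu hgi hgM hhi hhM hhM' hL0 hL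
  calc ∫⁻ x : Fin 2 → E4, ENNReal.ofReal ‖(K (x 0 - x 1) : ℂ) * D x‖
      = ‖W default‖ₑ ^ 2 * ∫⁻ x : Fin 2 → E4,
          ‖K (x 0 - x 1)‖ₑ * ‖f₁ (fun _ => timeReflection 4 (x 0))‖ₑ * ‖f₁ (fun _ => x 1)‖ₑ := by
        rw [lintegral_congr hpt, lintegral_const_mul' _ _ (ENNReal.pow_ne_top enorm_ne_top)]
    _ = ‖W default‖ₑ ^ 2 * ∫⁻ z : E4 × E4,
          ‖K (z.1 - z.2)‖ₑ * ‖f₁ (fun _ => timeReflection 4 z.1)‖ₑ * ‖f₁ (fun _ => z.2)‖ₑ := by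
        rw [← (volume_preserving_finTwoArrow E4).lintegral_comp_emb MeasurableEquiv.finTwoArrow.measurableEmbedding]
        rfl
    _ ≤ ‖W default‖ₑ ^ 2 * ENNReal.ofReal (max C 0 * (Mg * Mh) * (Mg * (Mh + u ^ (η - 8) * L * Mh'))) := by
        gcongr
    _ = _ := by rw [← ofReal_norm, ← ENNReal.ofReal_pow (norm_nonneg _), ← ENNReal.ofReal_mul (sq_nonneg _)]

end SandwichVacuumRow

open SandwichVacuumRow

/-! ### The calibration lemma (registered stub) -/

/-- **CALIBRATION: THE VACUUM ROW OF Σ IS A THEOREM UNDER THE KERNEL TRIPLE, WITH EXPONENT `4 − η/2`** (registered stub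
`stub_sandwichVacuumRowOfKernel` of crux stmt-QuantumFields-11686, line `complex-rotation-bandlimit`, generation 12).  For a
one-species family `S₁` on `ℝ⁴` with an `e₀`-reconstruction `h`, normalised in degree `0`, whose two-point function on `⁰𝒮` is a
kernel `K(x₀ − x₁)`, continuous off `0`, with `|K x| ≤ C (1 + ‖x‖^(η−10))`, `0 < η ≤ 2`: there is `C'` depending on `C, η` only
(namely `C' = √(C⁺ (1 + L_η))`, `C⁺ = max C 0`, `L_η = ∫_{ℝ²} (1 + |w|²)^{−(10−η)/2} dw < ∞`) such that for all `0 < u, v ≤ 1`,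
every factorised insertion `f₁ = g ⊗ hh` with the times of `g` in `[u, 2u]`, `∫|g| ≤ Mg`, `∫|hh| ≤ Mh`, `|hh| ≤ Mh'`, and every
degree-zero `W`: `‖Ψ_{f₁ ⊗ W_{(2u+v)e₀}}‖ ≤ C' · Mg · (Mh + Mh') · (u^{−(4−η/2)} + v^{−(4−η/2)}) · ‖Ψ_W‖` — the `n = 0` row of Σ
with `μ = 4 − η/2 < 4`.  Proof: `‖Ψ_W‖ = |W()|` (`norm_fieldVec_zero`), `‖Ψ_{f₁ ⊗ W}‖² ≤ |W()|² C⁺ Mg² Mh (Mh + u^{η−8} L Mh')`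
(`norm_fieldVec_one_sq_le`), `Mh (Mh + u^{η−8} L Mh') ≤ (1 + L)(Mh + Mh')² u^{η−8}` for `u ≤ 1`, and
`u^{η−8} = (u^{−(4−η/2)})² ≤ (u^{−(4−η/2)} + v^{−(4−η/2)})²`.  The continuity of `K` is not used. [folklore] -/
theorem stub_sandwichVacuumRowOfKernel :
    open Literature.MathematicalPhysics.QuantumLattice Literature.MathematicalPhysics.AQFT
      Literature.MathematicalPhysics.QuantumFieldTheory
      Summit.QuantumFields.YangMills.Theorems.NPointIsotropy.Negative in
    ∀ (S₁ : SchwingerFamily E4) (h : OSReconstructionNoE1 S₁.toLabelled), S₁.toLabelled.IsNormalized →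
      ∀ (K : E4 → ℝ) (C η : ℝ), 0 < η → η ≤ 2 → ContinuousOn K {x : E4 | x ≠ 0} →
        (∀ x : E4, x ≠ 0 → |K x| ≤ C * (1 + ‖x‖ ^ (η - 10))) →
        (∀ F : SchwartzMap (Fin 2 → E4) ℂ, IsOffDiagonal F →
            MeasureTheory.Integrable (fun x : Fin 2 → E4 => (K (x 0 - x 1) : ℂ) * F x) ∧
              S₁ 2 F = ∫ x : Fin 2 → E4, (K (x 0 - x 1) : ℂ) * F x) →
        ∃ C' : ℝ, ∀ (u v : ℝ), 0 < u → 0 < v → u ≤ 1 → v ≤ 1 →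
           ∀ (f₁ : SchwartzMap (Fin 1 → E4) ℂ) (g hh : ℝ × ℝ → ℂ) (Mg Mh Mh' : ℝ),
             (∀ x : Fin 1 → E4, f₁ x = g (x 0 0, x 0 1) * hh (x 0 2, x 0 3)) →
             (∀ p : ℝ × ℝ, g p ≠ 0 → u ≤ p.1 ∧ p.1 ≤ 2 * u) →
             MeasureTheory.Integrable g → (∫ p, ‖g p‖) ≤ Mg →
             MeasureTheory.Integrable hh → (∫ p, ‖hh p‖) ≤ Mh → (∀ p, ‖hh p‖ ≤ Mh') →
           ∀ (W : SchwartzMap (Fin 0 → E4) ℂ) (hW : IsTimeOrdered W)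
             (hFW : IsTimeOrdered
               (SchwartzMap.appendTensor f₁ (translateMulti ((2 * u + v) • EuclideanSpace.single 0 1) W))),
             ‖h.fieldVec (1 + 0) (fun _ => ())
                 (SchwartzMap.appendTensor f₁ (translateMulti ((2 * u + v) • EuclideanSpace.single 0 1) W)) hFW‖
               ≤ C' * Mg * (Mh + Mh') * (u ^ (-(4 - η / 2)) + v ^ (-(4 - η / 2))) *
                 ‖h.fieldVec 0 (fun _ => ()) W hW‖ := by
  intro S₁ h h0 K C η _ hη2 _ hK hK2
  have hLtop := lintegral_bracket_lt_top η hη2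
  obtain ⟨L, hL0, hL, -⟩ : ∃ L : ℝ, 0 ≤ L ∧
      (∫⁻ w : ℝ × ℝ, ENNReal.ofReal ((1 + ‖w‖ ^ 2) ^ (-(10 - η) / 2)) ≤ ENNReal.ofReal L) ∧ True :=
    ⟨_, ENNReal.toReal_nonneg, (ENNReal.ofReal_toReal hLtop.ne).ge, trivial⟩
  refine ⟨Real.sqrt (max C 0 * (1 + L)), ?_⟩
  intro u v hu hv hu1 _ f₁ g hh Mg Mh Mh' hf₁ hgu hgi hgM hhi hhM hhM' W hW hFW
  have hMg : 0 ≤ Mg := (integral_nonneg fun _ => norm_nonneg _).trans hgM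
  have hMh : 0 ≤ Mh := (integral_nonneg fun _ => norm_nonneg _).trans hhM
  have hMh' : 0 ≤ Mh' := (norm_nonneg _).trans (hhM' 0)
  have hC : 0 ≤ max C 0 := le_max_right _ _
  have hsq := norm_fieldVec_one_sq_le h hη2 hu hK hK2 f₁ hf₁ hgu hgi hgM hhi hhM hhM' hL0 hL _ W hFW
  rw [norm_fieldVec_zero h h0 W hW]
  -- bookkeeping: `Mh (Mh + t L Mh') ≤ (1 + L)(Mh + Mh')² t`, `t = u^{η-8} ≤ (u^{-μ} + v^{-μ})²`
  have ht1 : 1 ≤ u ^ (η - 8) := Real.one_le_rpow_of_pos_of_le_one_of_nonpos hu hu1 (by linarith)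
  have hU : u ^ (η - 8) ≤ (u ^ (-(4 - η / 2)) + v ^ (-(4 - η / 2))) ^ 2 := by
    have e : u ^ (η - 8) = (u ^ (-(4 - η / 2))) ^ 2 := by
      rw [← Real.rpow_natCast, ← Real.rpow_mul hu.le]; congr 1; push_cast; ring
    rw [e]
    gcongr
    exact le_add_of_nonneg_right (Real.rpow_nonneg hv.le _)
  have key : Mh * (Mh + u ^ (η - 8) * L * Mh') ≤
      (1 + L) * (Mh + Mh') ^ 2 * (u ^ (-(4 - η / 2)) + v ^ (-(4 - η / 2))) ^ 2 := by
    calc Mh * (Mh + u ^ (η - 8) * L * Mh')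
        ≤ (Mh + Mh') * (u ^ (η - 8) * (1 + L) * (Mh + Mh')) := by
          apply mul_le_mul (le_add_of_nonneg_right hMh') _ (by positivity) (by positivity)
          nlinarith [mul_nonneg (sub_nonneg.2 ht1) hMh, mul_nonneg (zero_le_one.trans ht1) hMh',
            mul_nonneg (mul_nonneg (zero_le_one.trans ht1) hL0) hMh]
      _ = (1 + L) * (Mh + Mh') ^ 2 * u ^ (η - 8) := by ring
      _ ≤ (1 + L) * (Mh + Mh') ^ 2 * (u ^ (-(4 - η / 2)) + v ^ (-(4 - η / 2))) ^ 2 := by gcongr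
  have hR : 0 ≤ Real.sqrt (max C 0 * (1 + L)) * Mg * (Mh + Mh') *
      (u ^ (-(4 - η / 2)) + v ^ (-(4 - η / 2))) * ‖W default‖ := by positivity
  refine le_of_pow_le_pow_left₀ two_ne_zero hR ?_
  calc ‖h.fieldVec (1 + 0) (fun _ => ())
          (f₁.appendTensor (translateMulti ((2 * u + v) • EuclideanSpace.single 0 1) W)) hFW‖ ^ 2
      ≤ ‖W default‖ ^ 2 * (max C 0 * (Mg * Mh) * (Mg * (Mh + u ^ (η - 8) * L * Mh'))) := hsq
    _ = ‖W default‖ ^ 2 * max C 0 * Mg ^ 2 * (Mh * (Mh + u ^ (η - 8) * L * Mh')) := by ring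
    _ ≤ ‖W default‖ ^ 2 * max C 0 * Mg ^ 2 *
          ((1 + L) * (Mh + Mh') ^ 2 * (u ^ (-(4 - η / 2)) + v ^ (-(4 - η / 2))) ^ 2) :=
        mul_le_mul_of_nonneg_left key (by positivity)
    _ = (Real.sqrt (max C 0 * (1 + L))) ^ 2 *
          (Mg ^ 2 * (Mh + Mh') ^ 2 * (u ^ (-(4 - η / 2)) + v ^ (-(4 - η / 2))) ^ 2 * ‖W default‖ ^ 2) := by
        rw [Real.sq_sqrt (by positivity)]; ring
    _ = _ := by ring

end Summit.QuantumFields.YangMills.Theorems.NPointIsotropy.ComplexRotationBandlimit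

end
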